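import Mathlib
import Summits.Ventures.PercRepro2.CoinChainBlindGenLemmas

/-!
# The GENERAL AND-switch chain with head-blind non-entries — the lifted law, second half
(blind cell PercRepro2, night-2 g20; proofs/NIGHT2-DARC.md §60.8)

`liftLawG`: the lifted law of the general chain on `insert x₀ U` (coin bit `Ber(ρ)` everywhere,
`ρ·e` on, `offG^e` off); `liftLawG_lsm` (log-supermodular), `liftLawG_cross` (the lifted gate
Holley-above the lifted `R`-law from every cluster containing `x₀` or meeting `ent`),
`liftLawG_off` (equal off the entries `insert x₀ ent`) — the hypotheses of
`gate_functional_nonneg` with the sure entry set `insert x₀ ent`.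
-/

namespace Summit.Ventures.PercRepro2.Coin

open Classical

section ChainBlindGenLift

variable {V : Type*} [DecidableEq V] {R : Type*} [Field R] [LinearOrder R] [IsStrictOrderedRing R]

/-- The lifted law of the general chain on `insert x₀ U` with head value `e` on the entered side
(`e = d`: the `R`-law; `e = d'`: the gate): `ρ·ν·e` with the coin on, `ν·offG^e` with it off. -/
def liftLawG (U ent ent' : Finset V) (x₀ : V) (ρ : R) (ν c d e : Finset V → R) (W' : Finset V) : R :=
  ν (W' ∩ U) * (if x₀ ∈ W' then ρ * e (W' ∩ U) else offG ent ent' ρ c d e (W' ∩ U))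

/-- The `on`/`off` factor of the lifted law is nonnegative. -/
lemma liftFactorG_nonneg (U ent ent' : Finset V) (x₀ : V) (ρ : R) (c d e : Finset V → R)
    (hρ0 : 0 ≤ ρ) (hρ1 : ρ ≤ 1) (hc0 : ∀ W, 0 ≤ c W) (hd0 : ∀ W, 0 ≤ d W)
    (he0 : ∀ W, 0 ≤ e W) (hdc : ∀ W, d W ≤ c W) (W' : Finset V) :
    0 ≤ (if x₀ ∈ W' then ρ * e (W' ∩ U) else offG ent ent' ρ c d e (W' ∩ U)) := by
  split_ifs
  · exact mul_nonneg hρ0 (he0 _)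
  · exact offG_nonneg ent ent' ρ c d e hρ0 hρ1 hc0 hd0 he0 hdc _

/-- The lifted law is nonnegative. -/
lemma liftLawG_nonneg (U ent ent' : Finset V) (x₀ : V) (ρ : R) (ν c d e : Finset V → R)
    (hρ0 : 0 ≤ ρ) (hρ1 : ρ ≤ 1) (hν0 : ∀ W, 0 ≤ ν W) (hc0 : ∀ W, 0 ≤ c W) (hd0 : ∀ W, 0 ≤ d W)
    (he0 : ∀ W, 0 ≤ e W) (hdc : ∀ W, d W ≤ c W) (W' : Finset V) :
    0 ≤ liftLawG U ent ent' x₀ ρ ν c d e W' :=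
  mul_nonneg (hν0 _) (liftFactorG_nonneg U ent ent' x₀ ρ c d e hρ0 hρ1 hc0 hd0 he0 hdc W')

/-- **The lifted law is log-supermodular.** -/
lemma liftLawG_lsm (U ent ent' : Finset V) (x₀ : V) (ρ : R) (ν c d e : Finset V → R)
    (hρ0 : 0 ≤ ρ) (hρ1 : ρ ≤ 1) (hν0 : ∀ W, 0 ≤ ν W)
    (hν : ∀ s ⊆ U, ∀ t ⊆ U, ν s * ν t ≤ ν (s ∩ t) * ν (s ∪ t))
    (hc0 : ∀ W, 0 ≤ c W) (hd0 : ∀ W, 0 ≤ d W) (he0 : ∀ W, 0 ≤ e W)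
    (hdc : ∀ W, d W ≤ c W) (hec : ∀ W, e W ≤ c W)
    (hcc : ∀ s t, c s * c t ≤ c (s ∩ t) * c (s ∪ t))
    (hee : ∀ s t, e s * e t ≤ e (s ∩ t) * e (s ∪ t))
    (hce : ∀ s t, c s * e t ≤ c (s ∩ t) * e (s ∪ t))
    (hbc : ∀ W, c W = c (W ∩ (ent ∪ ent'))) (hbd : ∀ W, d W = d (W ∩ (ent ∪ ent')))
    (hbe : ∀ W, e W = e (W ∩ (ent ∪ ent'))) (s t : Finset V) :
    liftLawG U ent ent' x₀ ρ ν c d e s * liftLawG U ent ent' x₀ ρ ν c d e t ≤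
      liftLawG U ent ent' x₀ ρ ν c d e (s ∩ t) * liftLawG U ent ent' x₀ ρ ν c d e (s ∪ t) := by
  have hI : (s ∩ t) ∩ U = (s ∩ U) ∩ (t ∩ U) := state_inter s t U
  have hU : (s ∪ t) ∩ U = (s ∩ U) ∪ (t ∩ U) := state_union s t U
  have hν' : ν (s ∩ U) * ν (t ∩ U) ≤ ν ((s ∩ t) ∩ U) * ν ((s ∪ t) ∩ U) := by
    rw [hI, hU]
    exact hν (s ∩ U) Finset.inter_subset_right (t ∩ U) Finset.inter_subset_right
  have hf : (if x₀ ∈ s then ρ * e (s ∩ U) else offG ent ent' ρ c d e (s ∩ U)) *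
      (if x₀ ∈ t then ρ * e (t ∩ U) else offG ent ent' ρ c d e (t ∩ U)) ≤
      (if x₀ ∈ s ∩ t then ρ * e ((s ∩ t) ∩ U) else offG ent ent' ρ c d e ((s ∩ t) ∩ U)) *
      (if x₀ ∈ s ∪ t then ρ * e ((s ∪ t) ∩ U) else offG ent ent' ρ c d e ((s ∪ t) ∩ U)) := by
    rw [hI, hU]
    by_cases hs : x₀ ∈ s <;> by_cases ht : x₀ ∈ t
    · rw [if_pos hs, if_pos ht, if_pos (Finset.mem_inter.2 ⟨hs, ht⟩),
        if_pos (Finset.mem_union_left _ hs)]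
      have := hee (s ∩ U) (t ∩ U)
      calc ρ * e (s ∩ U) * (ρ * e (t ∩ U)) = (ρ * ρ) * (e (s ∩ U) * e (t ∩ U)) := by ring
        _ ≤ (ρ * ρ) * (e (s ∩ U ∩ (t ∩ U)) * e (s ∩ U ∪ t ∩ U)) :=
            mul_le_mul_of_nonneg_left this (mul_nonneg hρ0 hρ0)
        _ = ρ * e (s ∩ U ∩ (t ∩ U)) * (ρ * e (s ∩ U ∪ t ∩ U)) := by ring
    · rw [if_pos hs, if_neg ht, if_neg (fun h => ht (Finset.mem_inter.1 h).2),
        if_pos (Finset.mem_union_left _ hs)]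
      have := offG_cross ent ent' ρ c d e e hρ0 hρ1 he0 hdc hec hce hee hbc hbd hbe (s ∩ U) (t ∩ U)
      calc ρ * e (s ∩ U) * offG ent ent' ρ c d e (t ∩ U)
          = ρ * (e (s ∩ U) * offG ent ent' ρ c d e (t ∩ U)) := by ring
        _ ≤ ρ * (offG ent ent' ρ c d e (s ∩ U ∩ (t ∩ U)) * e (s ∩ U ∪ t ∩ U)) :=
            mul_le_mul_of_nonneg_left this hρ0
        _ = offG ent ent' ρ c d e (s ∩ U ∩ (t ∩ U)) * (ρ * e (s ∩ U ∪ t ∩ U)) := by ring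
    · rw [if_neg hs, if_pos ht, if_neg (fun h => hs (Finset.mem_inter.1 h).1),
        if_pos (Finset.mem_union_right _ ht)]
      have := offG_cross ent ent' ρ c d e e hρ0 hρ1 he0 hdc hec hce hee hbc hbd hbe (t ∩ U) (s ∩ U)
      rw [Finset.inter_comm (t ∩ U), Finset.union_comm (t ∩ U)] at this
      calc offG ent ent' ρ c d e (s ∩ U) * (ρ * e (t ∩ U))
          = ρ * (e (t ∩ U) * offG ent ent' ρ c d e (s ∩ U)) := by ring
        _ ≤ ρ * (offG ent ent' ρ c d e (s ∩ U ∩ (t ∩ U)) * e (s ∩ U ∪ t ∩ U)) :=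
            mul_le_mul_of_nonneg_left this hρ0
        _ = offG ent ent' ρ c d e (s ∩ U ∩ (t ∩ U)) * (ρ * e (s ∩ U ∪ t ∩ U)) := by ring
    · rw [if_neg hs, if_neg ht, if_neg (fun h => hs (Finset.mem_inter.1 h).1),
        if_neg (fun h => by rcases Finset.mem_union.1 h with h | h; exact hs h; exact ht h)]
      exact offG_lsm ent ent' ρ c d e hρ0 hρ1 hc0 he0 hdc hec hcc hee hce hbc hbd hbe (s ∩ U) (t ∩ U)
  unfold liftLawG
  calc ν (s ∩ U) * (if x₀ ∈ s then ρ * e (s ∩ U) else offG ent ent' ρ c d e (s ∩ U)) *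
        (ν (t ∩ U) * (if x₀ ∈ t then ρ * e (t ∩ U) else offG ent ent' ρ c d e (t ∩ U)))
      = (ν (s ∩ U) * ν (t ∩ U)) *
          ((if x₀ ∈ s then ρ * e (s ∩ U) else offG ent ent' ρ c d e (s ∩ U)) *
           (if x₀ ∈ t then ρ * e (t ∩ U) else offG ent ent' ρ c d e (t ∩ U))) := by ring
    _ ≤ (ν ((s ∩ t) ∩ U) * ν ((s ∪ t) ∩ U)) *
          ((if x₀ ∈ s ∩ t then ρ * e ((s ∩ t) ∩ U) else offG ent ent' ρ c d e ((s ∩ t) ∩ U)) *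
           (if x₀ ∈ s ∪ t then ρ * e ((s ∪ t) ∩ U) else offG ent ent' ρ c d e ((s ∪ t) ∩ U))) :=
        mul_le_mul hν' hf
          (mul_nonneg (liftFactorG_nonneg U ent ent' x₀ ρ c d e hρ0 hρ1 hc0 hd0 he0 hdc s)
            (liftFactorG_nonneg U ent ent' x₀ ρ c d e hρ0 hρ1 hc0 hd0 he0 hdc t))
          (mul_nonneg (hν0 _) (hν0 _))
    _ = _ := by ring

/-- **The lifted gate is Holley-above the lifted `R`-law from every cluster containing `x₀` or
meeting `ent`**: `liftG s · liftR t ≤ liftR (s ∩ t) · liftG (s ∪ t)`. -/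
lemma liftLawG_cross (U ent ent' : Finset V) (x₀ : V) (ρ : R) (ν c d d' : Finset V → R)
    (hρ0 : 0 ≤ ρ) (hρ1 : ρ ≤ 1) (hν0 : ∀ W, 0 ≤ ν W)
    (hν : ∀ s ⊆ U, ∀ t ⊆ U, ν s * ν t ≤ ν (s ∩ t) * ν (s ∪ t))
    (hc0 : ∀ W, 0 ≤ c W) (hd0 : ∀ W, 0 ≤ d W) (hd'0 : ∀ W, 0 ≤ d' W)
    (hdc : ∀ W, d W ≤ c W) (hd'd : ∀ W, d' W ≤ d W)
    (hdd' : ∀ s t, d s * d' t ≤ d (s ∩ t) * d' (s ∪ t))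
    (hcd' : ∀ s t, c s * d' t ≤ c (s ∩ t) * d' (s ∪ t))
    (hbc : ∀ W, c W = c (W ∩ (ent ∪ ent'))) (hbd : ∀ W, d W = d (W ∩ (ent ∪ ent')))
    (hbd' : ∀ W, d' W = d' (W ∩ (ent ∪ ent'))) (s t : Finset V)
    (hs : x₀ ∈ s ∨ ∃ r ∈ ent, r ∈ s ∩ U) :
    liftLawG U ent ent' x₀ ρ ν c d d' s * liftLawG U ent ent' x₀ ρ ν c d d t ≤
      liftLawG U ent ent' x₀ ρ ν c d d (s ∩ t) * liftLawG U ent ent' x₀ ρ ν c d d' (s ∪ t) := by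
  have hI : (s ∩ t) ∩ U = (s ∩ U) ∩ (t ∩ U) := state_inter s t U
  have hU : (s ∪ t) ∩ U = (s ∩ U) ∪ (t ∩ U) := state_union s t U
  have hν' : ν (s ∩ U) * ν (t ∩ U) ≤ ν ((s ∩ t) ∩ U) * ν ((s ∪ t) ∩ U) := by
    rw [hI, hU]
    exact hν (s ∩ U) Finset.inter_subset_right (t ∩ U) Finset.inter_subset_right
  have hd'c : ∀ W, d' W ≤ c W := fun W => le_trans (hd'd W) (hdc W)
  have h1ρ : 0 ≤ 1 - ρ := by linarith
  have hcross := offG_cross ent ent' ρ c d d' d hρ0 hρ1 hd'0 hdc hdc hcd' hdd' hbc hbd hbd'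
    (s ∩ U) (t ∩ U)
  have hf : (if x₀ ∈ s then ρ * d' (s ∩ U) else offG ent ent' ρ c d d' (s ∩ U)) *
      (if x₀ ∈ t then ρ * d (t ∩ U) else offG ent ent' ρ c d d (t ∩ U)) ≤
      (if x₀ ∈ s ∩ t then ρ * d ((s ∩ t) ∩ U) else offG ent ent' ρ c d d ((s ∩ t) ∩ U)) *
      (if x₀ ∈ s ∪ t then ρ * d' ((s ∪ t) ∩ U) else offG ent ent' ρ c d d' ((s ∪ t) ∩ U)) := by
    rw [hI, hU]
    by_cases hxs : x₀ ∈ s <;> by_cases hxt : x₀ ∈ t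
    · rw [if_pos hxs, if_pos hxt, if_pos (Finset.mem_inter.2 ⟨hxs, hxt⟩),
        if_pos (Finset.mem_union_left _ hxs)]
      have := hdd' (t ∩ U) (s ∩ U)
      rw [Finset.inter_comm (t ∩ U), Finset.union_comm (t ∩ U)] at this
      calc ρ * d' (s ∩ U) * (ρ * d (t ∩ U)) = (ρ * ρ) * (d (t ∩ U) * d' (s ∩ U)) := by ring
        _ ≤ (ρ * ρ) * (d (s ∩ U ∩ (t ∩ U)) * d' (s ∩ U ∪ t ∩ U)) :=
            mul_le_mul_of_nonneg_left this (mul_nonneg hρ0 hρ0)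
        _ = ρ * d (s ∩ U ∩ (t ∩ U)) * (ρ * d' (s ∩ U ∪ t ∩ U)) := by ring
    · rw [if_pos hxs, if_neg hxt, if_neg (fun h => hxt (Finset.mem_inter.1 h).2),
        if_pos (Finset.mem_union_left _ hxs)]
      calc ρ * d' (s ∩ U) * offG ent ent' ρ c d d (t ∩ U)
          = ρ * (d' (s ∩ U) * offG ent ent' ρ c d d (t ∩ U)) := by ring
        _ ≤ ρ * (offG ent ent' ρ c d d (s ∩ U ∩ (t ∩ U)) * d' (s ∩ U ∪ t ∩ U)) :=
            mul_le_mul_of_nonneg_left hcross hρ0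
        _ = offG ent ent' ρ c d d (s ∩ U ∩ (t ∩ U)) * (ρ * d' (s ∩ U ∪ t ∩ U)) := by ring
    · have hsE : ∃ r ∈ ent, r ∈ s ∩ U := hs.resolve_left hxs
      rw [if_neg hxs, if_pos hxt, if_neg (fun h => hxs (Finset.mem_inter.1 h).1),
        if_pos (Finset.mem_union_right _ hxt)]
      have hge := offG_ge ent ent' ρ c d d hρ0 hρ1 hdc hdc (s ∩ U ∩ (t ∩ U))
      have h2 := hdd' (t ∩ U) (s ∩ U)
      rw [Finset.inter_comm (t ∩ U), Finset.union_comm (t ∩ U)] at h2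
      have hS : offG ent ent' ρ c d d' (s ∩ U) = (1 - ρ) * d' (s ∩ U) := by unfold offG; rw [if_pos hsE]
      rw [hS]
      calc (1 - ρ) * d' (s ∩ U) * (ρ * d (t ∩ U)) = ρ * (1 - ρ) * (d (t ∩ U) * d' (s ∩ U)) := by ring
        _ ≤ ρ * (1 - ρ) * (d (s ∩ U ∩ (t ∩ U)) * d' (s ∩ U ∪ t ∩ U)) :=
            mul_le_mul_of_nonneg_left h2 (mul_nonneg hρ0 h1ρ)
        _ = ((1 - ρ) * d (s ∩ U ∩ (t ∩ U))) * (ρ * d' (s ∩ U ∪ t ∩ U)) := by ring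
        _ ≤ offG ent ent' ρ c d d (s ∩ U ∩ (t ∩ U)) * (ρ * d' (s ∩ U ∪ t ∩ U)) :=
            mul_le_mul_of_nonneg_right hge (mul_nonneg hρ0 (hd'0 _))
    · have hsE : ∃ r ∈ ent, r ∈ s ∩ U := hs.resolve_left hxs
      have huE : ∃ r ∈ ent, r ∈ s ∩ U ∪ t ∩ U := meets_union_iff.2 (Or.inl hsE)
      rw [if_neg hxs, if_neg hxt, if_neg (fun h => hxs (Finset.mem_inter.1 h).1),
        if_neg (fun h => by rcases Finset.mem_union.1 h with h | h; exact hxs h; exact hxt h)]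
      have hS : offG ent ent' ρ c d d' (s ∩ U) = (1 - ρ) * d' (s ∩ U) := by unfold offG; rw [if_pos hsE]
      have hU' : offG ent ent' ρ c d d' (s ∩ U ∪ t ∩ U) = (1 - ρ) * d' (s ∩ U ∪ t ∩ U) := by
        unfold offG; rw [if_pos huE]
      rw [hS, hU']
      calc (1 - ρ) * d' (s ∩ U) * offG ent ent' ρ c d d (t ∩ U)
          = (1 - ρ) * (d' (s ∩ U) * offG ent ent' ρ c d d (t ∩ U)) := by ring
        _ ≤ (1 - ρ) * (offG ent ent' ρ c d d (s ∩ U ∩ (t ∩ U)) * d' (s ∩ U ∪ t ∩ U)) :=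
            mul_le_mul_of_nonneg_left hcross h1ρ
        _ = offG ent ent' ρ c d d (s ∩ U ∩ (t ∩ U)) * ((1 - ρ) * d' (s ∩ U ∪ t ∩ U)) := by ring
  unfold liftLawG
  calc ν (s ∩ U) * (if x₀ ∈ s then ρ * d' (s ∩ U) else offG ent ent' ρ c d d' (s ∩ U)) *
        (ν (t ∩ U) * (if x₀ ∈ t then ρ * d (t ∩ U) else offG ent ent' ρ c d d (t ∩ U)))
      = (ν (s ∩ U) * ν (t ∩ U)) *
          ((if x₀ ∈ s then ρ * d' (s ∩ U) else offG ent ent' ρ c d d' (s ∩ U)) *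
           (if x₀ ∈ t then ρ * d (t ∩ U) else offG ent ent' ρ c d d (t ∩ U))) := by ring
    _ ≤ (ν ((s ∩ t) ∩ U) * ν ((s ∪ t) ∩ U)) *
          ((if x₀ ∈ s ∩ t then ρ * d ((s ∩ t) ∩ U) else offG ent ent' ρ c d d ((s ∩ t) ∩ U)) *
           (if x₀ ∈ s ∪ t then ρ * d' ((s ∪ t) ∩ U) else offG ent ent' ρ c d d' ((s ∪ t) ∩ U))) :=
        mul_le_mul hν' hf
          (mul_nonneg (liftFactorG_nonneg U ent ent' x₀ ρ c d d' hρ0 hρ1 hc0 hd0 hd'0 hdc s)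
            (liftFactorG_nonneg U ent ent' x₀ ρ c d d hρ0 hρ1 hc0 hd0 hd0 hdc t))
          (mul_nonneg (hν0 _) (hν0 _))
    _ = _ := by ring

omit [LinearOrder R] [IsStrictOrderedRing R] in
/-- Off the entries `insert x₀ ent` the lifted gate equals the lifted `R`-law. -/
lemma liftLawG_off (U ent ent' : Finset V) (x₀ : V) (ρ : R) (ν c d d' : Finset V → R)
    (W' : Finset V) (hW' : W' ∩ insert x₀ ent = ∅) :
    liftLawG U ent ent' x₀ ρ ν c d d' W' = liftLawG U ent ent' x₀ ρ ν c d d W' := by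
  have hx : x₀ ∉ W' := fun h => by
    have : x₀ ∈ W' ∩ insert x₀ ent := Finset.mem_inter.2 ⟨h, Finset.mem_insert_self _ _⟩
    rw [hW'] at this
    exact Finset.notMem_empty _ this
  have hE : ¬ ∃ r ∈ ent, r ∈ W' ∩ U := fun ⟨r, hr, hrW⟩ => by
    have : r ∈ W' ∩ insert x₀ ent :=
      Finset.mem_inter.2 ⟨(Finset.mem_inter.1 hrW).1, Finset.mem_insert_of_mem hr⟩
    rw [hW'] at this
    exact Finset.notMem_empty _ this
  unfold liftLawG offG
  rw [if_neg hx, if_neg hx, if_neg hE, if_neg hE]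

end ChainBlindGenLift

end Summit.Ventures.PercRepro2.Coin
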